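import Summits.Ventures.YMGap.RobustBall.StarKernelSusceptibilityBall
import Summits.Ventures.YMGap.RobustBall.StarKernelSusceptibilityRate
import Summits.Ventures.YMGap.RobustBall.OneStateBoundary
import Summits.Ventures.YMGap.RobustBall.BoundaryDecayTorus
import Summits.Ventures.YMGap.Thresholds.CouplingDerivativeTools
import HarnessLib

/-!
# Venture YMGap, track DS / Y2 ROBUST-BALL (seat ds-3) — «C-KMIX-STAR» on the gauge-invariant tier-1 `ℤ⁴` ball, step 5 (rate): for every member
# of `MemBallZdG (3/125) (3/250) R` and every `0 ≤ β_W ≤ 1/3`, the box susceptibility with ANY boundary field converges to the member's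
# infinite-volume susceptibility EXPONENTIALLY FAST in the box size

HONEST FRAMING. WHAT THIS IS: a venture file (cell `pub-ymgap`, seat ds-3; theorems only, no `def`, no named fact): the ball twin of
`StarKernelSusceptibilityRate.lean`, with ds-2's robust star door (locality radius `max R 1 + 2`, divisor `E = max R 1 + 4`, certified `ρ⋆`) in place
of the Wilson door: the near plaquettes by the member's box boundary-insensitivity (`su2_box_boundary_decay_star_ball_upTo_oneThird`, from
`StarKernelClusteringBall.su2_boundary_decay_star_ball_upTo_oneThird`), the far ones and the tail by the uniform box majorant of
`StarKernelSusceptibilityBall.lean`; the unique state and the boundary limit from `su2_massGapOnBallZdG_star_upTo_oneThird` + `boundaryLimit_of_perturbedMassGapAt`.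
* `su2_box_boundary_decay_star_ball_upTo_oneThird` — `|∫F dγ^W_{box M}(·|η) − ∫F dμ| ≤ 2√2 · K · #Δ · ρ⋆^{⌊(M+1−M′)/E⌋}` for `F` on links based in `box 4 M′`;
* ★★ `su2_kernel_susceptibility_star_ball_rate_upTo_oneThird` — the explicit two-piece exponential bound in `M − P`, uniform in `η`, for EVERY member.
WHAT THIS IS NOT: the rate is astronomically weak; interior form; lattice strong coupling; nothing about the continuum limit or the Clay problem.

References: the seat's `StarKernelSusceptibilityRate.lean` (ported line by line), `StarKernelSusceptibilityBall.lean`, `StarKernelClusteringBall.lean`,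
`OneStateBoundary.lean`; ds-2's `MassGapOnBallZdGRows.lean`.
-/

noncomputable section

open MeasureTheory Filter Function ProbabilityTheory Real Topology
open scoped NNReal
open Literature.Probability.LatticeModels
open Literature.MathematicalPhysics.QuantumLattice hiding torusNorm
open Literature.MathematicalPhysics.QuantumFieldTheory hiding ZdEdge Site
open Summit.Ventures.YMGap.DSWindowZd
open Summit.Ventures.YMGap.StarResolventDim (gaugeR)
open Summit.Ventures.YMGap.CouplingResponse (isLipschitzCylinder_mul)

namespace Summit.Ventures.YMGap.RobustBall

/-- **The member's box forgets its boundary field** (`SU(2)`, `d = 4`, `0 ≤ β_W ≤ 1/3`, every member of `MemBallZdG (3/125) (3/250) R`, every DLR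
state `μ` of the member): for `Λ₀ =` links based in `box 4 M`, EVERY `η` and a Lipschitz cylinder `F` on links based in `box 4 M′`, `M′ ≤ M`:
`|∫F dγ^W_{box M}(·|η) − ∫F dμ| ≤ 2√2 · K · #Δ · ρ⋆^{⌊(M + 1 − M′)/(max R 1 + 4)⌋}`. [folklore] -/
theorem su2_box_boundary_decay_star_ball_upTo_oneThird {βW : ℝ} (h0 : 0 ≤ βW) (h : βW ≤ 1 / 3) {R : ℕ}
    {W : Potential (ZdEdge 4) (SUN 2)} {supp : Finset (ZdEdge 4) → Finset (Finset (ZdEdge 4))}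
    (hW : MemBallZdG (3 / 125) (3 / 250) R W supp)
    {μ : Measure (LGConfig 4 (SUN 2))}
    (hμ : μ ∈ perturbedGibbsMeasures (d := 4) (fundamentalRep (Fin 2)) ((2 : ℕ) * (βW / 4)) W supp)
    {M M' : ℕ} (hMM : M' ≤ M) (η : LGConfig 4 (SUN 2)) {F : LGConfig 4 (SUN 2) → ℝ} {Δ : Finset (ZdEdge 4)} {K : ℝ≥0}
    (hF : IsLipschitzCylinder (fundamentalRep (Fin 2)) F Δ K) (hΔ : Δ ⊆ (box 4 M') ×ˢ (Finset.univ : Finset (Fin 4))) :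
    |(∫ U, F U ∂(perturbedYM (d := 4) (fundamentalRep (Fin 2)) ((2 : ℕ) * (βW / 4)) W supp
        ((box 4 M) ×ˢ (Finset.univ : Finset (Fin 4))) η)) - ∫ U, F U ∂μ| ≤
      2 * Real.sqrt 2 * K * Δ.card *
        (gaugeR 4 (17651 / 200000 : ℝ) + ((16971 / 1000000 : ℝ) + (6 * (17651 / 200000 : ℝ) + 16971 / 1000000) ^ 20 * (16 * (16971 / 1000000 : ℝ))) / (1 - (6 * (17651 / 200000 : ℝ) + 16971 / 1000000))) ^ ⌊((M : ℝ) + 1 - M') / (max R 1 + 2 + 2 : ℕ)⌋₊ := by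
  classical
  have hΔ' : Δ ⊆ (box 4 M) ×ˢ (Finset.univ : Finset (Fin 4)) := fun x hx => by
    have h1 := Finset.mem_product.1 (hΔ hx)
    refine Finset.mem_product.2 ⟨mem_box.2 fun i => ?_, Finset.mem_univ _⟩
    have := (mem_box.1 h1.1) i
    omega
  refine su2_boundary_decay_star_ball_upTo_oneThird h0 h hW hμ _ η (fun x => (M : ℝ) + 1 - supNormZd x.1)
    (fun x y => ?_) (fun x hx => ?_) hF hΔ' (fun x hx => ?_)
  · have h1 := supNormZd_le_supNormZd_add_norm y.1 x.1
    rw [norm_sub_rev] at h1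
    linarith
  · refine Finset.mem_product.2 ⟨mem_box.2 fun i => ?_, Finset.mem_univ _⟩
    have h1 : (supNormZd x.1 : ℝ) < M + 1 := by linarith
    have h1' : supNormZd x.1 < M + 1 := by exact_mod_cast h1
    have h3 := natAbs_le_supNormZd x.1 i
    omega
  · have h1 := Finset.mem_product.1 (hΔ hx)
    have h2 : supNormZd x.1 ≤ M' := supNormZd_le_iff.2 fun i => by
      have := (mem_box.1 h1.1) i
      omega
    have h3 : (supNormZd x.1 : ℝ) ≤ M' := by exact_mod_cast h2
    linarith

/-- ★★ **THE MEMBER'S FINITE-VOLUME SUSCEPTIBILITY WITH ANY BOUNDARY FIELD CONVERGES EXPONENTIALLY FAST IN THE BOX SIZE** (`SU(2)`, `ℤ⁴`,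
every `0 ≤ β_W ≤ 1/3`, every member of `MemBallZdG (3/125) (3/250) R`): the member's DLR states form a singleton `{μ}` and for every `M > P`,
EVERY boundary field `η` and every plaquette `p` based in `box 4 P`, with `E = max R 1 + 4`, `L = (M − P)/2`, `t = −log max(ρ⋆, ½)`, `s = e^{−t/(8E)}`:
`|Σ_{q based in box M} cov_{γ^W_{box M}(·|η)}(W_p, W_q) − Σ_q cov_μ(W_p, W_q)| ≤ 6(2(P+L)+1)⁴ · 1536√2 · ρ⋆^{⌊(M+1−(P+L+1))/E⌋}`
`+ 2 · (262144 e^{t((2P+2)/E+1)}) · s^L · 6((1+s)/(1−s))⁴`, the infinite-volume row being absolutely summable. [folklore] -/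
theorem su2_kernel_susceptibility_star_ball_rate_upTo_oneThird {βW : ℝ} (h0 : 0 ≤ βW) (h : βW ≤ 1 / 3) {R : ℕ}
    {W : Potential (ZdEdge 4) (SUN 2)} {supp : Finset (ZdEdge 4) → Finset (Finset (ZdEdge 4))}
    (hW : MemBallZdG (3 / 125) (3 / 250) R W supp) :
    ∃ μ : Measure (LGConfig 4 (SUN 2)),
      perturbedGibbsMeasures (d := 4) (fundamentalRep (Fin 2)) ((2 : ℕ) * (βW / 4)) W supp = {μ} ∧
      ∀ (M P : ℕ), P < M → ∀ (η : LGConfig 4 (SUN 2)) (p : ZdPlaquette 4), p.1 ∈ box 4 P →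
        (Summable fun q : ZdPlaquette 4 =>
            cov[zdPlaquetteObs (fundamentalRep (Fin 2)) p.1 p.2.1.1 p.2.1.2,
              zdPlaquetteObs (fundamentalRep (Fin 2)) q.1 q.2.1.1 q.2.1.2; μ]) ∧
        |(∑ q ∈ (box 4 M) ×ˢ (Finset.univ : Finset {o : Fin 4 × Fin 4 // o.1 < o.2}),
            cov[zdPlaquetteObs (fundamentalRep (Fin 2)) p.1 p.2.1.1 p.2.1.2,
              zdPlaquetteObs (fundamentalRep (Fin 2)) q.1 q.2.1.1 q.2.1.2;
              perturbedYM (d := 4) (fundamentalRep (Fin 2)) ((2 : ℕ) * (βW / 4)) W supp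
                ((box 4 M) ×ˢ (Finset.univ : Finset (Fin 4))) η]) -
            ∑' q : ZdPlaquette 4, cov[zdPlaquetteObs (fundamentalRep (Fin 2)) p.1 p.2.1.1 p.2.1.2,
              zdPlaquetteObs (fundamentalRep (Fin 2)) q.1 q.2.1.1 q.2.1.2; μ]| ≤
          6 * (2 * ((P + (M - P) / 2 : ℕ) : ℝ) + 1) ^ 4 * (1536 * Real.sqrt 2) *
              (gaugeR 4 (17651 / 200000 : ℝ) + ((16971 / 1000000 : ℝ) + (6 * (17651 / 200000 : ℝ) + 16971 / 1000000) ^ 20 * (16 * (16971 / 1000000 : ℝ))) / (1 - (6 * (17651 / 200000 : ℝ) + 16971 / 1000000))) ^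
                ⌊((M : ℝ) + 1 - ((P + (M - P) / 2 + 1 : ℕ) : ℝ)) / (max R 1 + 2 + 2 : ℕ)⌋₊ +
            2 * (262144 * Real.exp (-Real.log (max (gaugeR 4 (17651 / 200000 : ℝ) + ((16971 / 1000000 : ℝ) + (6 * (17651 / 200000 : ℝ) + 16971 / 1000000) ^ 20 * (16 * (16971 / 1000000 : ℝ))) / (1 - (6 * (17651 / 200000 : ℝ) + 16971 / 1000000))) (1 / 2)) * ((2 * P + 2) / (max R 1 + 2 + 2 : ℕ) + 1))) *
              Real.exp (-(-Real.log (max (gaugeR 4 (17651 / 200000 : ℝ) + ((16971 / 1000000 : ℝ) + (6 * (17651 / 200000 : ℝ) + 16971 / 1000000) ^ 20 * (16 * (16971 / 1000000 : ℝ))) / (1 - (6 * (17651 / 200000 : ℝ) + 16971 / 1000000))) (1 / 2)) / (max R 1 + 2 + 2 : ℕ) / 8)) ^ ((M - P) / 2) *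
              (6 * ((1 + Real.exp (-(-Real.log (max (gaugeR 4 (17651 / 200000 : ℝ) + ((16971 / 1000000 : ℝ) + (6 * (17651 / 200000 : ℝ) + 16971 / 1000000) ^ 20 * (16 * (16971 / 1000000 : ℝ))) / (1 - (6 * (17651 / 200000 : ℝ) + 16971 / 1000000))) (1 / 2)) / (max R 1 + 2 + 2 : ℕ) / 8))) /
                (1 - Real.exp (-(-Real.log (max (gaugeR 4 (17651 / 200000 : ℝ) + ((16971 / 1000000 : ℝ) + (6 * (17651 / 200000 : ℝ) + 16971 / 1000000) ^ 20 * (16 * (16971 / 1000000 : ℝ))) / (1 - (6 * (17651 / 200000 : ℝ) + 16971 / 1000000))) (1 / 2)) / (max R 1 + 2 + 2 : ℕ) / 8)))) ^ 4) := by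
  classical
  -- the member's unique state and its boundary-limit theorem along the centred boxes
  have hgap : PerturbedMassGapAt 4 2 (βW / 4) W supp := su2_massGapOnBallZdG_star_upTo_oneThird h0 h R W supp hW
  obtain ⟨μ, hG, hlim⟩ := boundaryLimit_of_perturbedMassGapAt hgap hW.continuous hW.dependsOn hW.supportedBy
  set ρs : ℝ := (gaugeR 4 (17651 / 200000 : ℝ) + ((16971 / 1000000 : ℝ) + (6 * (17651 / 200000 : ℝ) + 16971 / 1000000) ^ 20 * (16 * (16971 / 1000000 : ℝ))) / (1 - (6 * (17651 / 200000 : ℝ) + 16971 / 1000000))) with hρs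
  have hμ : μ ∈ perturbedGibbsMeasures (d := 4) (fundamentalRep (Fin 2)) ((2 : ℕ) * (βW / 4)) W supp := by rw [hG]; exact Set.mem_singleton μ
  have hμG : IsGibbsMeasure (perturbedYM (d := 4) (fundamentalRep (Fin 2)) ((2 : ℕ) * (βW / 4)) W supp) μ := hμ
  haveI := hμG.isProbabilityMeasure
  refine ⟨μ, hG, fun M P hPM η p hp => ?_⟩
  set Λs : ℕ → Finset (ZdEdge 4) := fun n => (box 4 n) ×ˢ (Finset.univ : Finset (Fin 4)) with hΛs
  have hcof : ∀ Δ : Finset (ZdEdge 4), ∀ᶠ n in atTop, Δ ⊆ Λs n := by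
    intro Δ
    refine eventually_atTop.2 ⟨Δ.sup fun e => supNormZd e.1, fun n hn e he => ?_⟩
    refine Finset.mem_product.2 ⟨mem_box.2 fun i => ?_, Finset.mem_univ _⟩
    have h1 : supNormZd e.1 ≤ n := (Finset.le_sup (f := fun e : ZdEdge 4 => supNormZd e.1) he).trans hn
    have h3 := natAbs_le_supNormZd e.1 i
    omega
  obtain ⟨hF, -⟩ := hlim Λs hcof
  set γ := perturbedYM (d := 4) (fundamentalRep (Fin 2)) ((2 : ℕ) * (βW / 4)) W supp with hγdef
  have hWb0 : ∀ X, ∃ C, ∀ U, |W X U| ≤ C := fun X => exists_bound_of_continuous (hW.continuous X)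
  have hγspec : IsSpecification γ :=
    isSpecification_perturbedYM _ (continuous_fundamentalRep (Fin 2)) _
      (fun X => ⟨hW.dependsOn X, (hW.continuous X).measurable⟩) hWb0 hW.supportedBy
  haveI hγprob : ∀ Λ ζ, IsProbabilityMeasure (γ Λ ζ) := fun Λ ζ => hγspec.isProbability Λ ζ
  set Wp : ZdPlaquette 4 → LGConfig 4 (SUN 2) → ℝ :=
    fun r => zdPlaquetteObs (fundamentalRep (Fin 2)) r.1 r.2.1.1 r.2.1.2 with hWp
  -- plaquette observables: Lipschitz cylinders (constant 32 on their four links), continuous, bounded by one, in `L²`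
  have hWlip : ∀ r : ZdPlaquette 4, IsLipschitzCylinder (fundamentalRep (Fin 2)) (Wp r) (plaquetteEdges r) (4 * (2 : ℝ≥0) ^ 3) :=
    fun r => isLipschitzCylinder_zdPlaquetteObs (N := 2) r.1 r.2.2
  have hWc : ∀ r : ZdPlaquette 4, Continuous (Wp r) := fun r => continuous_of_isLipschitzCylinder (hWlip r)
  have hWb : ∀ r : ZdPlaquette 4, ∀ U, |Wp r U| ≤ 1 := fun r U =>
    abs_zdPlaquetteObs_le fundamentalRep_mem_unitaryGroup r.1 r.2.1.1 r.2.1.2 U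
  have hWb' : ∀ r : ZdPlaquette 4, ∀ U, |Wp r U| ≤ ((1 : ℝ≥0) : ℝ) := fun r U => by rw [NNReal.coe_one]; exact hWb r U
  have hWmem : ∀ (r : ZdPlaquette 4) (ν : Measure (LGConfig 4 (SUN 2))) [IsProbabilityMeasure ν], MemLp (Wp r) 2 ν :=
    fun r ν _ => memLp_of_bounded (a := -1) (b := 1)
      (ae_of_all _ fun U => by simp only [Set.mem_Icc]; exact abs_le.1 (hWb r U)) (hWc r).measurable.aestronglyMeasurable 2
  have hWint : ∀ (r : ZdPlaquette 4) (ν : Measure (LGConfig 4 (SUN 2))) [IsProbabilityMeasure ν], |∫ U, Wp r U ∂ν| ≤ 1 :=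
    fun r ν _ => by
      have := norm_integral_le_of_norm_le_const (μ := ν) (f := Wp r) (C := 1)
        (ae_of_all _ fun U => by rw [Real.norm_eq_abs]; exact hWb r U)
      simpa [Real.norm_eq_abs, probReal_univ] using this
  have hcov : ∀ (q : ZdPlaquette 4) (ν : Measure (LGConfig 4 (SUN 2))) [IsProbabilityMeasure ν],
      cov[Wp p, Wp q; ν] = (∫ U, Wp p U * Wp q U ∂ν) - (∫ U, Wp p U ∂ν) * ∫ U, Wp q U ∂ν :=
    fun q ν _ => covariance_eq_sub (hWmem p _) (hWmem q _)
  -- termwise convergence along the boxes with the boundary fields frozen to `η`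
  have hterm : ∀ q : ZdPlaquette 4, Tendsto (fun n => cov[Wp p, Wp q; γ (Λs n) η]) atTop (𝓝 (cov[Wp p, Wp q; μ])) := by
    intro q
    have h1 := hF (fun _ => η) (fun U => Wp p U * Wp q U) ((hWc p).mul (hWc q))
      ⟨1, fun U => by rw [abs_mul]; exact mul_le_one₀ (hWb p U) (abs_nonneg _) (hWb q U)⟩
    have h2 := hF (fun _ => η) (Wp p) (hWc p) ⟨1, hWb p⟩
    have h3 := hF (fun _ => η) (Wp q) (hWc q) ⟨1, hWb q⟩
    have hcovn : ∀ n, cov[Wp p, Wp q; γ (Λs n) η] =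
        (∫ U, Wp p U * Wp q U ∂(γ (Λs n) η)) - (∫ U, Wp p U ∂(γ (Λs n) η)) * ∫ U, Wp q U ∂(γ (Λs n) η) :=
      fun n => hcov q _
    rw [show (fun n => cov[Wp p, Wp q; γ (Λs n) η]) = fun n =>
        (∫ U, Wp p U * Wp q U ∂(γ (Λs n) η)) - (∫ U, Wp p U ∂(γ (Λs n) η)) * ∫ U, Wp q U ∂(γ (Λs n) η) from funext hcovn,
      hcov q μ]
    exact h1.sub (h2.mul h3)
  -- the uniform box majorant (star kernel door, saturation absorbed) and its limit for `μ`
  have hρ0 : 0 ≤ ρs := by rw [hρs]; unfold gaugeR StarResolventDim.Delta; norm_num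
  have hρ1 : ρs < 1 := by rw [hρs]; unfold gaugeR StarResolventDim.Delta; norm_num
  set E : ℕ := max R 1 + 2 + 2 with hEdef
  have hE0 : (0 : ℝ) < (E : ℝ) := by rw [hEdef]; positivity
  set t : ℝ := -Real.log (max ρs (1 / 2)) with ht
  have ht0 : 0 < t := by
    rw [ht, neg_pos]
    exact Real.log_neg (lt_max_of_lt_right (by norm_num)) (max_lt hρ1 (by norm_num))
  set C : ℝ := 262144 * Real.exp (t * ((2 * P + 2) / E + 1)) with hC
  have hC0 : 0 ≤ C := by positivity
  set s : ℝ := Real.exp (-(t / E / 8)) with hs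
  have hs0 : 0 ≤ s := (Real.exp_pos _).le
  have hs1 : s < 1 := Real.exp_lt_one_iff.2 (by rw [neg_neg_iff_pos]; positivity)
  set r : ℝ := Real.exp (-(t / E / (4 : ℕ))) with hr
  have hr0 : 0 ≤ r := (Real.exp_pos _).le
  have hr1 : r < 1 := Real.exp_lt_one_iff.2 (neg_neg_of_pos (by positivity))
  have hrs : r = s * s := by rw [hr, hs, ← Real.exp_add]; congr 1; push_cast; ring
  have hbound : ∀ (n : ℕ), P < n → ∀ q : ZdPlaquette 4, q.1 ∈ box 4 n →
      |cov[Wp p, Wp q; γ (Λs n) η]| ≤ C * r ^ l1 (p.1 - q.1) := by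
    intro n hn q hq
    have hk := su2_abs_cov_plaquette_kernel_box_ball_upTo_oneThird h0 h hW hn η hp hq
    refine hk.trans ?_
    rw [← hρs, ← hEdef, ← ht, ← hC]
    refine mul_le_mul_of_nonneg_left ?_ hC0
    have := exp_neg_norm_le_pow (d := 4) (by norm_num) (m := t / E) (by positivity) (p.1 - q.1)
    rw [hr]
    convert this using 2
  have hboundμ : ∀ q : ZdPlaquette 4, |cov[Wp p, Wp q; μ]| ≤ C * r ^ l1 (p.1 - q.1) := by
    intro q
    refine le_of_tendsto ((hterm q).abs) ?_
    refine eventually_atTop.2 ⟨max (P + 1) (supNormZd q.1), fun n hn => hbound n ?_ q ?_⟩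
    · exact lt_of_lt_of_le (Nat.lt_succ_self P) ((le_max_left _ _).trans hn)
    · refine mem_box.2 fun i => ?_
      have h1 : supNormZd q.1 ≤ n := (le_max_right _ _).trans hn
      have h3 := natAbs_le_supNormZd q.1 i
      omega
  have hsumμ : Summable fun q : ZdPlaquette 4 => cov[Wp p, Wp q; μ] :=
    Summable.of_norm_bounded (summable_and_tsum_row_le (d := 4) hC0 hr0 hr1 p).1
      fun q => by rw [Real.norm_eq_abs]; exact hboundμ q
  refine ⟨hsumμ, ?_⟩
  -- the truncated kernel row `f q = 𝟙[q based in box M] cov_M` and its `tsum`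
  set S : ℕ → Finset (ZdPlaquette 4) := fun n => (box 4 n) ×ˢ (Finset.univ : Finset {o : Fin 4 × Fin 4 // o.1 < o.2}) with hS
  set f : ZdPlaquette 4 → ℝ := fun q => if q ∈ S M then cov[Wp p, Wp q; γ (Λs M) η] else 0 with hf
  have hfS : ∑' q, f q = ∑ q ∈ S M, cov[Wp p, Wp q; γ (Λs M) η] := by
    rw [tsum_eq_sum (s := S M) (fun q hq => if_neg hq)]
    exact Finset.sum_congr rfl fun q hq => if_pos hq
  have hfb : ∀ q, |f q| ≤ C * r ^ l1 (p.1 - q.1) := by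
    intro q
    simp only [hf]
    split_ifs with hq
    · exact hbound M hPM q (Finset.mem_product.1 hq).1
    · rw [abs_zero]; positivity
  have hsumf : Summable f :=
    Summable.of_norm_bounded (summable_and_tsum_row_le (d := 4) hC0 hr0 hr1 p).1
      fun q => by rw [Real.norm_eq_abs]; exact hfb q
  -- the split: `near` = based in `box 4 (P + L)`, handled by boundary insensitivity; the rest by the majorants
  set L : ℕ := (M - P) / 2 with hL
  have hLM : P + L + 1 ≤ M := by omega
  set Bn : ℝ := 1536 * Real.sqrt 2 * ρs ^ ⌊((M : ℝ) + 1 - ((P + L + 1 : ℕ) : ℝ)) / (E : ℕ)⌋₊ with hBn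
  have hBn0 : 0 ≤ Bn := by positivity
  have hnear : ∀ q : ZdPlaquette 4, q ∈ S (P + L) → |f q - cov[Wp p, Wp q; μ]| ≤ Bn := by
    intro q hq
    have hq' : q.1 ∈ box 4 (P + L) := (Finset.mem_product.1 hq).1
    have hqM : q ∈ S M := by
      refine Finset.mem_product.2 ⟨mem_box.2 fun i => ?_, Finset.mem_univ _⟩
      have := (mem_box.1 hq') i
      omega
    have hfq : f q = cov[Wp p, Wp q; γ (Λs M) η] := if_pos hqM
    rw [hfq]
    -- supports inside `box 4 (P + L + 1)`
    have hp' : p.1 ∈ box 4 (P + L) := by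
      refine mem_box.2 fun i => ?_
      have := (mem_box.1 hp) i
      omega
    have hΔp := plaquetteEdges_subset_box_succ hp'
    have hΔq := plaquetteEdges_subset_box_succ hq'
    have hΔpq : plaquetteEdges p ∪ plaquetteEdges q ⊆ (box 4 (P + L + 1)) ×ˢ (Finset.univ : Finset (Fin 4)) :=
      Finset.union_subset hΔp hΔq
    have hprod : IsLipschitzCylinder (fundamentalRep (Fin 2)) (fun U => Wp p U * Wp q U)
        (plaquetteEdges p ∪ plaquetteEdges q) (1 * (4 * (2 : ℝ≥0) ^ 3) + 1 * (4 * (2 : ℝ≥0) ^ 3)) :=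
      isLipschitzCylinder_mul (hWlip p) (hWlip q) (hWb' p) (hWb' q)
    have hcardU : ((plaquetteEdges p ∪ plaquetteEdges q).card : ℝ) ≤ 8 := by
      have := (Finset.card_union_le _ _).trans (add_le_add (card_plaquetteEdges_le p) (card_plaquetteEdges_le q))
      exact_mod_cast this
    have hcardp : ((plaquetteEdges p).card : ℝ) ≤ 4 := by exact_mod_cast card_plaquetteEdges_le p
    have hcardq : ((plaquetteEdges q).card : ℝ) ≤ 4 := by exact_mod_cast card_plaquetteEdges_le q
    have hK : (((1 * (4 * (2 : ℝ≥0) ^ 3) + 1 * (4 * (2 : ℝ≥0) ^ 3) : ℝ≥0)) : ℝ) = 64 := by norm_num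
    have hK' : (((4 * (2 : ℝ≥0) ^ 3 : ℝ≥0)) : ℝ) = 32 := by norm_num
    set ρk : ℝ := ρs ^ ⌊((M : ℝ) + 1 - ((P + L + 1 : ℕ) : ℝ)) / (E : ℕ)⌋₊ with hρk
    have hρk0 : 0 ≤ ρk := pow_nonneg hρ0 _
    have ha : |(∫ U, Wp p U * Wp q U ∂(γ (Λs M) η)) - ∫ U, Wp p U * Wp q U ∂μ| ≤ 2 * Real.sqrt 2 * 64 * 8 * ρk := by
      have h0 := su2_box_boundary_decay_star_ball_upTo_oneThird h0 h hW hμ hLM η hprod hΔpq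
      rw [hK, ← hρs, ← hEdef] at h0
      refine h0.trans ?_
      rw [hρk]
      gcongr
    have hb : |(∫ U, Wp p U ∂(γ (Λs M) η)) - ∫ U, Wp p U ∂μ| ≤ 2 * Real.sqrt 2 * 32 * 4 * ρk := by
      have h0 := su2_box_boundary_decay_star_ball_upTo_oneThird h0 h hW hμ hLM η (hWlip p) hΔp
      rw [hK', ← hρs, ← hEdef] at h0
      refine h0.trans ?_
      rw [hρk]
      gcongr
    have hc' : |(∫ U, Wp q U ∂(γ (Λs M) η)) - ∫ U, Wp q U ∂μ| ≤ 2 * Real.sqrt 2 * 32 * 4 * ρk := by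
      have h0 := su2_box_boundary_decay_star_ball_upTo_oneThird h0 h hW hμ hLM η (hWlip q) hΔq
      rw [hK', ← hρs, ← hEdef] at h0
      refine h0.trans ?_
      rw [hρk]
      gcongr
    rw [hcov q (γ (Λs M) η), hcov q μ]
    set a := ∫ U, Wp p U * Wp q U ∂(γ (Λs M) η)
    set a' := ∫ U, Wp p U * Wp q U ∂μ
    set b := ∫ U, Wp p U ∂(γ (Λs M) η)
    set b' := ∫ U, Wp p U ∂μ
    set e := ∫ U, Wp q U ∂(γ (Λs M) η)
    set e' := ∫ U, Wp q U ∂μ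
    have hbe : |b| * |e - e'| + |e'| * |b - b'| ≤ |e - e'| + |b - b'| := by
      have h1 : |b| * |e - e'| ≤ 1 * |e - e'| := mul_le_mul_of_nonneg_right (hWint p (γ (Λs M) η)) (abs_nonneg _)
      have h2 : |e'| * |b - b'| ≤ 1 * |b - b'| := mul_le_mul_of_nonneg_right (hWint q μ) (abs_nonneg _)
      linarith
    calc |a - b * e - (a' - b' * e')| = |(a - a') - (b * (e - e') + e' * (b - b'))| := by
          rw [show a - b * e - (a' - b' * e') = (a - a') - (b * (e - e') + e' * (b - b')) by ring]
      _ ≤ |a - a'| + |b * (e - e') + e' * (b - b')| := abs_sub _ _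
      _ ≤ |a - a'| + (|b * (e - e')| + |e' * (b - b')|) := by gcongr; exact abs_add_le _ _
      _ = |a - a'| + (|b| * |e - e'| + |e'| * |b - b'|) := by rw [abs_mul, abs_mul]
      _ ≤ |a - a'| + (|e - e'| + |b - b'|) := by linarith
      _ ≤ 2 * Real.sqrt 2 * 64 * 8 * ρk + (2 * Real.sqrt 2 * 32 * 4 * ρk + 2 * Real.sqrt 2 * 32 * 4 * ρk) := by
          gcongr
      _ = Bn := by rw [hBn, hρk]; ring
  have hfar : ∀ q : ZdPlaquette 4, q ∉ S (P + L) → |f q - cov[Wp p, Wp q; μ]| ≤ 2 * C * s ^ L * s ^ l1 (p.1 - q.1) := by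
    intro q hq
    -- `‖x_q‖_∞ > P + L`, so `‖x_p − x_q‖₁ ≥ ‖x_p − x_q‖_∞ ≥ L + 1`
    have hl1 : L ≤ l1 (p.1 - q.1) := by
      have hqn : ¬ q.1 ∈ box 4 (P + L) := fun h' => hq (Finset.mem_product.2 ⟨h', Finset.mem_univ _⟩)
      rw [mem_box] at hqn
      push Not at hqn
      obtain ⟨i, hi⟩ := hqn
      have hpi := (mem_box.1 hp) i
      have hcoord : (L : ℤ) ≤ |(p.1 - q.1) i| := by
        rw [Pi.sub_apply]
        rcases le_or_gt (-((P : ℤ) + L)) (q.1 i) with hle | hlt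
        · have := hi hle
          rw [abs_sub_comm, abs_of_nonneg (by omega)]
          push_cast at this ⊢; omega
        · rw [abs_of_nonneg (by omega)]
          omega
      have h1 : ((p.1 - q.1) i).natAbs ≤ l1 (p.1 - q.1) :=
        Finset.single_le_sum (f := fun j => ((p.1 - q.1) j).natAbs) (fun j _ => Nat.zero_le _) (Finset.mem_univ i)
      have h2 : (L : ℤ) ≤ ((p.1 - q.1) i).natAbs := by rw [Int.natCast_natAbs]; exact hcoord
      omega
    have hsl : s ^ l1 (p.1 - q.1) ≤ s ^ L := pow_le_pow_of_le_one hs0 hs1.le hl1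
    calc |f q - cov[Wp p, Wp q; μ]| ≤ |f q| + |cov[Wp p, Wp q; μ]| := abs_sub _ _
      _ ≤ C * r ^ l1 (p.1 - q.1) + C * r ^ l1 (p.1 - q.1) := add_le_add (hfb q) (hboundμ q)
      _ = 2 * C * (s ^ l1 (p.1 - q.1) * s ^ l1 (p.1 - q.1)) := by rw [hrs, mul_pow]; ring
      _ ≤ 2 * C * (s ^ L * s ^ l1 (p.1 - q.1)) :=
          mul_le_mul_of_nonneg_left (mul_le_mul_of_nonneg_right hsl (by positivity)) (by positivity)
      _ = 2 * C * s ^ L * s ^ l1 (p.1 - q.1) := by ring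
  -- the majorant and its sum
  set g : ZdPlaquette 4 → ℝ := fun q => (if q ∈ S (P + L) then Bn else 0) + 2 * C * s ^ L * s ^ l1 (p.1 - q.1) with hg
  have hmaj : ∀ q : ZdPlaquette 4, |f q - cov[Wp p, Wp q; μ]| ≤ g q := by
    intro q
    simp only [hg]
    by_cases hq : q ∈ S (P + L)
    · rw [if_pos hq]
      exact (hnear q hq).trans (le_add_of_nonneg_right (by positivity))
    · rw [if_neg hq, zero_add]
      exact hfar q hq
  have hrow2 := summable_and_tsum_row_le (d := 4) (c := 2 * C * s ^ L) (by positivity) hs0 hs1 p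
  have hind : Summable fun q : ZdPlaquette 4 => (if q ∈ S (P + L) then Bn else 0) :=
    summable_of_ne_finset_zero (s := S (P + L)) fun q hq => if_neg hq
  have hindsum : ∑' q : ZdPlaquette 4, (if q ∈ S (P + L) then Bn else 0) = (S (P + L)).card * Bn := by
    rw [tsum_eq_sum (s := S (P + L)) (fun q hq => if_neg hq), Finset.sum_ite_of_true (fun q hq => hq), Finset.sum_const,
      nsmul_eq_mul]
  have hcardS : ((S (P + L)).card : ℝ) = 6 * (2 * ((P + L : ℕ) : ℝ) + 1) ^ 4 := by
    rw [hS]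
    simp only [Finset.card_product, card_box, Finset.card_univ]
    rw [show Fintype.card {o : Fin 4 × Fin 4 // o.1 < o.2} = numOrient 4 from rfl, numOrient_four]
    push_cast
    ring
  have hgs : Summable g := hind.add hrow2.1
  have habs : Summable fun q : ZdPlaquette 4 => |f q - cov[Wp p, Wp q; μ]| := (hsumf.sub hsumμ).abs
  have htsum : |(∑' q, f q) - ∑' q, cov[Wp p, Wp q; μ]| ≤ ∑' q, g q := by
    rw [← hsumf.tsum_sub hsumμ]
    have h1 := norm_tsum_le_tsum_norm (f := fun q : ZdPlaquette 4 => f q - cov[Wp p, Wp q; μ])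
      (by simpa only [Real.norm_eq_abs] using habs)
    simp only [Real.norm_eq_abs] at h1
    exact h1.trans (habs.tsum_le_tsum hmaj hgs)
  have hsumg : ∑' q, g q ≤ (S (P + L)).card * Bn + 2 * C * s ^ L * (numOrient 4 * ((1 + s) / (1 - s)) ^ 4) := by
    show ∑' q : ZdPlaquette 4, ((if q ∈ S (P + L) then Bn else 0) + 2 * C * s ^ L * s ^ l1 (p.1 - q.1)) ≤ _
    rw [hind.tsum_add hrow2.1, hindsum]
    exact add_le_add le_rfl hrow2.2
  rw [← hfS]
  refine htsum.trans (hsumg.trans (le_of_eq ?_))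
  rw [hcardS, numOrient_four, hBn, hC, ht, hs]
  push_cast
  ring

end Summit.Ventures.YMGap.RobustBall

end
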